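import Summits.Langlands.Langlands.Theses.IrreducibilityBySelfDuality
import Summits.Langlands.Langlands.Theorems.IrreducibilityBySelfDualityIrreducibleOffSectorIsobaricRigidity
import HarnessLib

/-!
# Stub `stub_isobaricRigidity` of line `Sketch` for the crux `IrreducibleOffSector`, BY NAME
(crux stmt-Langlands-14329, route `route-Langlands-IrreducibilityBySelfDuality`; `--supports` file)

The registered stub takes the route's input items `PairLBoundaryJS` (Arthur–Clozel (2.2) for
Borel–Jacquet data, definitionally the Literature named fact
`JacquetShalika1981_partialPairL_boundary_repData`) and `ContragredientDatum` (now a theorem of the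
tree, `CuspidalAutomorphicRepData.exists_contragredient_satake_holds`, so the hypothesis is not
used) and the named fact (2.3) `JacquetShalika1981_partialPairL_pole_repData`, and concludes the
k-ary isobaric rigidity of cuspidal Satake families; it is the structural theorem
`isobaricRigidity_of_JS` (module `…IrreducibleOffSectorIsobaricRigidity`, Literature-level
statement, no import of the Theses file) read through the definitional identity of the item with
the fact.  This module imports the Theses file (it names route decls) and is therefore not for use
inside `closes`; the structural theorem is.
-/

noncomputable section

set_option linter.dupNamespace false

open scoped NumberField
open Filter IsDedekindDomain
open Literature.NumberTheory.Automorphic Literature.NumberTheory.GaloisRepresentations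
open Summit.Langlands.Langlands.Theses.IrreducibilityBySelfDuality

namespace Summit.Langlands.Langlands.Theorems.IrreducibleOffSector

/-- **Stub `stub_isobaricRigidity` (line `Sketch`, crux `IrreducibleOffSector`)**: granted the
route inputs `PairLBoundaryJS` (Arthur–Clozel (2.2)), `ContragredientDatum` (unused: a theorem of
the tree) and the named fact `JacquetShalika1981_partialPairL_pole_repData` (Arthur–Clozel (2.3)),
the Satake family of a cuspidal `π` on `GL_n(𝔸_K)` (`n ≥ 1`) is not, at almost all places, the
union of the Satake families of `k ≥ 2` cuspidal representations of smaller general linear groups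
(Jacquet–Shalika 1981 II, Thm. 4.4) — `isobaricRigidity_of_JS`, the item `PairLBoundaryJS` being
definitionally the fact (2.2). [cite: JacquetShalikaAJM1981II, Thm. 4.4]
[cite: ArthurClozelAMS120, Ch. 3 §2 (2.1)–(2.4)] -/
theorem stub_isobaricRigidity :
    PairLBoundaryJS → ContragredientDatum → JacquetShalika1981_partialPairL_pole_repData →
    ∀ (K : Type) [Field K] [NumberField K] (n : ℕ) (hcpt : isCompact_glFiniteIntegralLevel n K),
      0 < n → ∀ (π : CuspidalAutomorphicRepData n K hcpt) (k : ℕ) (m : Fin k → ℕ)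
      (hm : ∀ i, isCompact_glFiniteIntegralLevel (m i) K)
      (σ : ∀ i, CuspidalAutomorphicRepData (m i) K (hm i)),
      2 ≤ k → (∀ i, 0 < m i) →
        ¬ ∀ᶠ v : HeightOneSpectrum (𝓞 K) in cofinite, ∀ α : Multiset ℂ, π.1.HasSatakeParamAt v α →
          ∃ β : Fin k → Multiset ℂ, (∀ i, (σ i).1.HasSatakeParamAt v (β i)) ∧ α = ∑ i, β i :=
  fun h22 _hC h23 K _ _ n hcpt hn π k m hm σ hk hmpos =>
    isobaricRigidity_of_JS h22 h23 K n hcpt hn π k m hm σ hk hmpos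

end Summit.Langlands.Langlands.Theorems.IrreducibleOffSector

end
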